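import Summits.AnomalousDissipation.AnomalousDissipation.Theorems.SolenoidalFractalHomogenisationLagrangianStepCellClauseCutsW
import HarnessLib

/-!
# K1L_D (stmt-AnomalousDissipation-27980), registry v4 (tenure D24-23): the HIGH-LABEL DECAY clause `HighLabelDecayW` — shared definition
# (`--kind definition --supports stmt-AnomalousDissipation-27980 --as helper`; prover-owned «DefsH», text = planner ad-ideate-p4 g12
#  `Cruxes/LagrangianRenormalisationStep/Lines/onelevel_highLabelDecay.lean` dcdcc2afc20b VERBATIM, re-homed in the Theorems namespace of the other
#  shared clause defs so that the v4 registry texts S23‴ / W7 `stub_highLabelDecay_IS` resolve to a LANDED declaration)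

WHY (p4 g12 F-p4g12-4 / lead F-lead-9 / tenure D24-22–23): at every frame reset the cell-scale correctors the true solution must carry are re-read with
their Bloch LABEL scrambled over `|Δℓ| ≲ Ca·θ(m+1)·N(m+1)`, i.e. onto fibres beyond the homogenisation range `ν/K` of the slow-vector clause (V) and below
the bare per-window viscous kill; in those fibres the slow–fast coupling is O(1), so no typed clause controlled the end-of-window fate of the (small,
dissipation-weighted) deposited energy.  The missing flat input is ν-UNIFORM decay of the cell dynamics on high Bloch labels (enhanced dissipation inside the
shear slots; Bedrossian–Coti Zelati 2017, Wei 2018, Wei–Zhang–Zhao 2020 type): this clause states it in the (M′) rate form with a prefactor; the per-period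
contraction (M♭) is its instance at `t = one design period`.  It is a HYPOTHESIS of S23‴ (`windowDefectH`) and the conclusion of the flat stub W7
`stub_highLabelDecay_IS` for the cubature design.  This file is a definition only; NOT a proof of anything; AD NOT proved; rung F-D1.A0.
-/

set_option linter.dupNamespace false

namespace Summit.AnomalousDissipation.AnomalousDissipation.Theorems.SolenoidalFractalHomogenisation.LagrangianStep

open Literature.Analysis Literature.Analysis.FluidPDE Literature.Analysis.FunctionSpaces
open MeasureTheory Set
open scoped InnerProductSpace

noncomputable section

/-- **(M′) HIGH-LABEL DECAY clause** for the design `W.stretch M` replayed quasi-statically at cell viscosity `ν` with `n` cells (prefix of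
`CellEnergyClausesW` verbatim).  For every admissible datum `F` carrying NO Fourier modes on Bloch labels of norm `< L` — i.e. `modeCoeff k' F = 0`
whenever `k' = ℓ + n·z` with `‖ℓ‖ < L` — where the label threshold is at or beyond `1/Kb` of the cell viscous scale, `n·ν ≤ Kb·L`, every weak solution of
the cell problem decays at the ν-UNIFORM rate `cK·ν`:  `∫‖u t‖² ≤ CK·exp(−2·cK·ν·t)·∫‖F‖²` for a.e. `t ∈ (0,T)`.
[cite: BedrossianCotiZelati2017, Thm 1.1 (enhanced dissipation in shear flows) — the mechanism; the clause itself is this route's hypothesis, text p4 g12] -/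
def HighLabelDecayW {k : ℕ} (W : LatticeShear.LatticeWord k) (M : ℝ) (hM : 0 < M) (lo hi Λ β ν₀ Kb CK cK : ℝ) : Prop :=
  ∀ ν, ∀ hν : ν ∈ Set.Ioo 0 ν₀, ∀ n : ℕ, 1 ≤ n → ∀ 𝔸 : Torus.Visc4 (Fin 3),
    Torus.OddSmall 𝔸 (ν * β) → (∃ lam ∈ Set.Icc (1:ℝ) Λ, Torus.NearIso 𝔸 (ν * (lo / lam)) (ν * (hi * lam))) →
    ∀ L > (0:ℝ), (n : ℝ) * ν ≤ Kb * L →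
    ∀ F : VF, IsDatum F →
      (∀ k' : Fin 3 → ℤ, (∃ ℓ z : Fin 3 → ℤ, ‖Torus.latticeVec ℓ‖ < L ∧ k' = ℓ + (n : ℤ) • z) → ∀ i, modeCoeff k' F i = 0) →
      ∀ T > (0:ℝ), ∀ u : ℝ → VF,
        Torus.IsWeakTensorPassiveVectorOn 0 T ((1 / (n:ℝ) ^ 2) • 𝔸) (cellField W M hM ν hν.1 n) F u →
        ∀ᵐ t ∂(volume.restrict (Ioo 0 T)),
          ∫ x, ‖u t x‖ ^ 2 ≤ CK * Real.exp (-(2 * cK * ν * t)) * ∫ x, ‖F x‖ ^ 2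

/-- The clause is monotone in the prefactor — a larger `CK` is weaker (degenerate-instance check). -/
theorem highLabelDecayW_mono_CK {k : ℕ} {W : LatticeShear.LatticeWord k} {M : ℝ} {hM : 0 < M} {lo hi Λ β ν₀ Kb CK CK' cK : ℝ}
    (hCK : CK ≤ CK') (h : HighLabelDecayW W M hM lo hi Λ β ν₀ Kb CK cK) : HighLabelDecayW W M hM lo hi Λ β ν₀ Kb CK' cK := by
  intro ν hν n hn 𝔸 hodd hwin L hL hKL F hF hlab T hT u hu
  filter_upwards [h ν hν n hn 𝔸 hodd hwin L hL hKL F hF hlab T hT u hu] with t ht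
  refine ht.trans ?_
  gcongr

end

end Summit.AnomalousDissipation.AnomalousDissipation.Theorems.SolenoidalFractalHomogenisation.LagrangianStep
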